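import Literature.MathematicalPhysics.QuantumFieldTheory.Balaban1983to89.B8Ineq159FlatCubeMemberSCGamma
import Literature.MathematicalPhysics.QuantumFieldTheory.Balaban1983to89.B8DentedCubeMemberLamBPrime
import Literature.MathematicalPhysics.QuantumFieldTheory.Balaban1983to89.B8Eq191FlatLettersDentedCubeMember

/-!
# `Balaban1983to89.B8Ineq159FlatDentedCubeMemberSCGamma` — [Balaban1985RegularSpaces] (1.59) p. 86 ∕ (1.62) p. 87 AT `U₀ = 1` ON THE DENTED CUBE MEMBER OF
# [Balaban1985Variational] (148)–(150), EVERY TRUNCATION: print's POINTWISE form ⟹ the flat line's SCALAR four-line clause; the uniform clause from the TWO named facts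
# (pure `Ineq159FlatCubeMemberPrinted` below the top, dented `Ineq159FlatDentedCubeMemberPrinted` at the top) — dented twin of Fγ10a `B8Ineq159FlatCubeMemberSCGamma`
# ((d3) MAP item (4))

statement-level skeleton of published theorems with citation tags; proofs where landed; nothing here is a claim about the
Yang–Mills mass gap

`[Balaban1985RegularSpaces]` ("B8" = [6], CMP **99** (1985) 75–102) (1.55)–(1.62) pp. 86–87, (1.31) p. 82, (1.131) p. 99, p. 98, p. 77; `[Balaban1985Variational]` ("[15]", CMP **102**
(1985) 277–309) (148)–(152) p. 301; [4] = `[Balaban1985BackgroundPropagators]` Thm 3.3 p. 399; [B6] = `[Balaban1984PropagatorsII]` (2.3) p. 224, Prop. 2.6 p. 247.  PDF held: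
`paper:balaban1985-cmp99-regular-spaces-gauge-fixing`, `paper:balaban1985-cmp102-variational-background` (pp. 24–25).

CITATION HEADER (lean-in-tree rule).  Cell `pub-ymgap` (HUMAN RULING D-0062, Track A), DAG node N05 = [B8], seat `pub-ymgap-dag-n05-e` (g31; row s3b, the (β) road; dag-n05-c standing
GO on dented twins I.42366).  WHY THIS FILE.  Fγ10a `B8Ineq159FlatCubeMemberSCGamma` (this seat g10) is the adapter turning the POINTWISE body of dag-n05-c's named fact
`Ineq159FlatCubeMemberPrinted` ((1.59) at `U₀ = 1` in the form (1.62), print's class `cubeLamBP`) into the SCALAR FOUR-LINE clause the γ re-assembly consumes, at every truncation of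
the PURE cube member.  The dented road needs the same at every truncation `m ≤ k` of the DENTED member `{Ω′_j}` (NODE 00's `CubeB8D`, p655171): for `m < k` the truncated dented
tower IS the pure member's, so the PURE fact (PROVED for odd `L ≥ 5`, `B8Ineq159FlatCubeMemberTransplant`) serves after a letter-by-letter translation; at `m = k` the DENTED fact
`B8Ineq159FlatDentedCubeMemberPrinted.Ineq159FlatDentedCubeMemberPrinted` (p659892, NAMED — its proof is the dented transplant (d2-b)∕(d2-c)) serves verbatim.  THIS FILE: §1 the
pointwise ⟹ four-line adapter at one dented datum, GENERIC in the averaging class (Fγ10a §1 with `cubeFam false ↦ c.sq`, `cubeLamS … m ↦ c.lamST m`, `cubeLamBP … m ↦ Cl`; finiteness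
of the side-touching pairs from the pure member's, `Ω′_j ⊆ □_j`); §2 print's FULL class of the dented member at every truncation, `CubeB8D.lamBPF` (pure `cubeLamBP … m` below the top,
`c.lamBP` at the top), and its inclusion in the γ SPLIT index `c.lamBPT m ∪ {level-0 crossing bonds of Ω′₀}` (`lamBPF_sub_splitIndex`; level `0` at the top by the dented
level-0 dictionary `mem_lamBP_zero_iff_lamB_or_crossB`); §3 ★★ `sc4_dented_of_ineq159Printed` — the UNIFORM four-line clause at every truncation of every dented datum of print's
big-block sub-lattice whose `Ω_k` satisfies the anchored dent premise, from the two named facts (constants∕thresholds merged by `max`).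

HONEST SCOPE ∕ A6.  §1, §2 unconditional; §3 CONDITIONAL on the two named facts (the pure one is PROVED in the tree for odd `L ≥ 5` — `ineq159FlatCubeMemberPrinted_holds` — and is
kept as a hypothesis here only to state §3 for general `L`; the dented one is OPEN).  `B_∂ = B₀` as in Fγ10a.  Count-neutral; N05 ∕ N07 NOT discharged; one finite `𝕋⁴` programme at
fixed `ε`, Bałaban as printed; nothing continuum ∕ ℝ⁴ ∕ OS ∕ mass-gap ∕ Clay.  No `sorry`, no `instance`, no `notation`; one `def` (`CubeB8D.lamBPF`).  Unit `pub-ymgap-dag-n05-e`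
(g31), 2026-08-28.

RELATED IN THE TREE, NOT DUPLICATED: `B8Ineq159FlatCubeMemberSCGamma.{sc4_of_pointwise159, sc4_cubeMember_of_ineq159Printed, cubeLamBP_sub_splitIndex}` (this seat g10; PURE member —
the model; `cubeLamBP_sub_splitIndex` USED below the top), `B8Ineq159FlatCubeMemberPerCube.sideTouches_pairs_finite` (dag-n05-w3; USED), `B8Ineq159FlatCubeMemberPrinted.
{cubeLamBP, Ineq159FlatCubeMemberPrinted, mem_cubeLamBP_zero_of_crossB}` (dag-n05-c), `B8Ineq159FlatDentedCubeMemberPrinted.{CubeB8D.lamBP, Ineq159FlatDentedCubeMemberPrinted,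
mem_lamBP_iff}` (p659892), `B8DentedCubeMemberLamBPrime.{CubeB8D.lamBPT, lamBPT_of_lt, lamBPT_top_zero, lamBPT_top_of_ne_zero, mem_lamS_of_ends}` (p662157),
`B8DentedCubeMemberZd.{CubeB8D.lamST, CubeB8D.lamB, lamST_of_lt, lamST_top, inBox_sq_of_mem_lamS}` (p661581), `B8Eq191FlatLettersDentedCubeMember.sq_subset_zero`.
-/

noncomputable section

namespace Literature.MathematicalPhysics.QuantumFieldTheory.Balaban1983to89.B8Ineq159FlatDentedCubeMemberSCGamma

open B7Prop1Explicit B7Prop2Explicit B7Prop1Local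
open B7Prop4GeneralLevels (linCovIter)
open B8Ineq132 (covDerivFwd BondTouches Under)
open B8Eq140Level (SideTouches sideTouches_mono sideTouches_of_bondTouches)
open B8Eq143PlaqExpansion (pdiv)
open B8Eq146AExpansion (iEta plaqCovDeriv)
open B8Eq155JBound (Jcur wsup wsup_le le_wsup wsup_nonneg)
open B8ScaledSupNorm (weight msup Bdd bondNorm msup_le msup_nonneg weight_mul_norm_le_msup weight_neg_natCast weight_nonneg)
open B8Eq138LandauZd (IsLandau138 covLap)
open B8Eq131Cubes (cube sqLo sqHi inLo inHi cube_succ_subset)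
open B8Eq131CubesAdmissible (cubeFam cubeFam_false_of_le cubeFam_false_zero smul_mem_cube_iff smul_mem_cube_succ_iff add_mem_cube_of_mem_succ)
open B8CubeMemberZd (cubeLamS cubeLamB cubeLamS_top)
open B8Ineq159FlatCubeMemberPrinted (cubeLamBP Ineq159FlatCubeMemberPrinted mem_cubeLamBP_iff mem_cubeLamBP_zero_of_crossB)
open B8Ineq159FlatCubeMemberPerCube (sideTouches_pairs_finite)
open B8Ineq159FlatCubeMemberSCGamma (cubeLamBP_sub_splitIndex)
open B9SupplySockB9P3ZdBeta (CrossB)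
open B9SupplySockB9P3ZdGamma (cubeLamBP')
open B8Ineq159FlatMaps (norm_Jcur_flat_le)
open B9Eq316TowerFlatIsOneStep (linCovIter_one_left)
open B7Prop4Flat (norm_linQIter_le)
open B8Ineq159FlatDentedCubeMemberPrinted (Ineq159FlatDentedCubeMemberPrinted mem_lamBP_iff)
open B8DentedCubeMemberZd (lamST_of_lt lamST_top inBox_sq_of_mem_lamS)
open B8DentedCubeMemberLamBPrime (lamBPT_of_lt lamBPT_top_zero lamBPT_top_of_ne_zero mem_lamS_of_ends)
open B8Eq191FlatLettersDentedCubeMember (sq_subset_zero)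
open Node00 (CubeB8D)
open Literature.MathematicalPhysics.QuantumLattice (blockMap)

export B7Prop1Explicit (Site)

variable {d : ℕ}

/-! ## §1 The pointwise body at one dented datum ⟹ the scalar four-line clause, any averaging class `Cl`, any index `⊇ Cl`, `B_∂ := B₀` -/

/-- ★★ **(1.59) AT `U₀ = 1` ON THE DENTED MEMBER, ONE DATUM: PRINT's POINTWISE FORM ⟹ THE FLAT LINE's SCALAR FOUR-LINE CLAUSE** — Fγ10a's `sc4_of_pointwise159` on the dented
tower `c.sq` with the truncated dented cells `c.lamST m` and an ARBITRARY averaging class `Cl` (print's `cubeLamBP … m` below the top, `c.lamBP` at the top): if the pointwise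
body holds with `B₀ ≥ 1` for every `φ` in the flat Landau gauge with the support clause, then for every index predicate `I ⊇ Cl` the four-line clause holds in the tree's norms,
`B_∂ := B₀`.  PROOF = Fγ10a's (finite support ⟹ the three right-hand suprema are attained; `N := |J|₍₋₃₎ + wsup + Φ₀`); the side-touching pairs of the dented tower are among the pure
member's (`Ω′_j ⊆ □_j`). [cite: Balaban1985RegularSpaces, (1.59) p.86, (1.62) p.87, (1.55) p.86, (1.31) p.82, (1.131) p.99, p.77; Balaban1985Variational, (148)–(152) p.301; Balaban1985BackgroundPropagators, Thm 3.3 p.399; Balaban1984PropagatorsII, (2.3) p.224] -/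
theorem sc4_of_pointwise159_dented (hd2 : 2 ≤ d) {L : ℕ} (hL : 1 ≤ L) {η : ℝ} (hη : 0 < η) {K : ℕ} {Ω : ℕ → Set (Site d)}
    (c : CubeB8D d L K Ω) {m : ℕ} (hmk : m ≤ c.k) {B₀ : ℝ} (hB₀ : 1 ≤ B₀) (Cl : ℕ → Set (Site d × Fin d))
    (I : ℕ → Site d × Fin d → Prop) (hI : ∀ j, j ≤ m → ∀ b ∈ Cl j, I j b)
    (hbody : ∀ φ : Site d → Fin d → ℂ,
      IsLandau138 L m η (c.sq 0) (c.lamST m) (1 : Site d → Fin d → ℂˣ) φ →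
      (∀ (y : Site d) (τ : Fin d), (∀ j, j ≤ m → ¬ SideTouches (c.sq j) y τ) → φ y τ = 0) →
      ∀ N : ℝ, 0 ≤ N →
        (∀ j, j ≤ m → ∀ (y : Site d) (τ : Fin d), BondTouches (c.sq j) y τ →
            ((L : ℝ) ^ j * η) ^ 3 * ‖Jcur η (1 : Site d → Fin d → ℂˣ) φ τ y‖ ≤ N) →
        (∀ j, j ≤ m → ∀ b ∈ Cl j,
            ‖linCovIter L (1 : Site d → Fin d → ℂˣ) (iEta η φ) j b.1 b.2‖ ≤ N) →
        (∀ (y : Site d) (τ : Fin d), ¬ BondTouches (c.sq 0) y τ → η * ‖φ y τ‖ ≤ N) →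
        ∀ j, j ≤ m → ∀ (y : Site d) (τ : Fin d), SideTouches (c.sq j) y τ →
          ((L : ℝ) ^ j * η) * ‖φ y τ‖ ≤ B₀ * N ∧
          (∀ ν : Fin d, ((L : ℝ) ^ j * η) ^ 2 *
            ‖covDerivFwd η (1 : Site d → Fin d → ℂˣ) ν (fun z => φ z τ) y‖ ≤ B₀ * N) ∧
          ((L : ℝ) ^ j * η) ^ 3 * ‖covLap η (1 : Site d → Fin d → ℂˣ) (fun z => φ z τ) y‖ ≤ B₀ * N)
    (φ : Site d → Fin d → ℂ)
    (hLan : IsLandau138 L m η (c.sq 0) (c.lamST m) (1 : Site d → Fin d → ℂˣ) φ)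
    (hsupp : ∀ (y : Site d) (τ : Fin d), (∀ j, j ≤ m → ¬ SideTouches (c.sq j) y τ) → φ y τ = 0) :
    msup L m η (-(1 : ℝ)) (fun j (b : Site d × Fin d) => SideTouches (c.sq j) b.1 b.2) (fun b => φ b.1 b.2)
        ≤ B₀ * (bondNorm L m η (-(3 : ℝ)) c.sq (fun x μ => Jcur η (1 : Site d → Fin d → ℂˣ) φ μ x)
          + wsup 1 (fun p : {p : ℕ × (Site d × Fin d) // p.1 ≤ m ∧ I p.1 p.2} =>
              linCovIter L (1 : Site d → Fin d → ℂˣ) (iEta η φ) p.1.1 p.1.2.1 p.1.2.2))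
          + B₀ * msup L m η (-(1 : ℝ)) (fun j (b : Site d × Fin d) => j = 0 ∧ SideTouches (c.sq 0) b.1 b.2 ∧
              ¬ BondTouches (c.sq 0) b.1 b.2) (fun b => φ b.1 b.2) ∧
      msup L m η (-(2 : ℝ)) (fun j (t : Fin d × Fin d × Site d) => SideTouches (c.sq j) t.2.2 t.2.1)
          (fun t => covDerivFwd η (1 : Site d → Fin d → ℂˣ) t.1 (fun z => φ z t.2.1) t.2.2)
        ≤ B₀ * (bondNorm L m η (-(3 : ℝ)) c.sq (fun x μ => Jcur η (1 : Site d → Fin d → ℂˣ) φ μ x)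
          + wsup 1 (fun p : {p : ℕ × (Site d × Fin d) // p.1 ≤ m ∧ I p.1 p.2} =>
              linCovIter L (1 : Site d → Fin d → ℂˣ) (iEta η φ) p.1.1 p.1.2.1 p.1.2.2))
          + B₀ * msup L m η (-(1 : ℝ)) (fun j (b : Site d × Fin d) => j = 0 ∧ SideTouches (c.sq 0) b.1 b.2 ∧
              ¬ BondTouches (c.sq 0) b.1 b.2) (fun b => φ b.1 b.2) ∧
      bondNorm L m η (-(3 : ℝ)) c.sq
          (fun x μ => pdiv η (1 : Site d → Fin d → ℂˣ) (plaqCovDeriv η (1 : Site d → Fin d → ℂˣ) φ) μ x)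
        ≤ B₀ * (bondNorm L m η (-(3 : ℝ)) c.sq (fun x μ => Jcur η (1 : Site d → Fin d → ℂˣ) φ μ x)
          + wsup 1 (fun p : {p : ℕ × (Site d × Fin d) // p.1 ≤ m ∧ I p.1 p.2} =>
              linCovIter L (1 : Site d → Fin d → ℂˣ) (iEta η φ) p.1.1 p.1.2.1 p.1.2.2))
          + B₀ * msup L m η (-(1 : ℝ)) (fun j (b : Site d × Fin d) => j = 0 ∧ SideTouches (c.sq 0) b.1 b.2 ∧
              ¬ BondTouches (c.sq 0) b.1 b.2) (fun b => φ b.1 b.2) ∧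
      bondNorm L m η (-(3 : ℝ)) c.sq (fun x μ => covLap η (1 : Site d → Fin d → ℂˣ) (fun z => φ z μ) x)
        ≤ B₀ * (bondNorm L m η (-(3 : ℝ)) c.sq (fun x μ => Jcur η (1 : Site d → Fin d → ℂˣ) φ μ x)
          + wsup 1 (fun p : {p : ℕ × (Site d × Fin d) // p.1 ≤ m ∧ I p.1 p.2} =>
              linCovIter L (1 : Site d → Fin d → ℂˣ) (iEta η φ) p.1.1 p.1.2.1 p.1.2.2))
          + B₀ * msup L m η (-(1 : ℝ)) (fun j (b : Site d × Fin d) => j = 0 ∧ SideTouches (c.sq 0) b.1 b.2 ∧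
              ¬ BondTouches (c.sq 0) b.1 b.2) (fun b => φ b.1 b.2) := by
  -- abbreviations for the three right-hand members
  obtain ⟨X, hX⟩ : ∃ X : ℝ, X = bondNorm L m η (-(3 : ℝ)) c.sq (fun x μ => Jcur η (1 : Site d → Fin d → ℂˣ) φ μ x) :=
    ⟨_, rfl⟩
  obtain ⟨Y, hY⟩ : ∃ Y : ℝ, Y = wsup 1 (fun p : {p : ℕ × (Site d × Fin d) // p.1 ≤ m ∧ I p.1 p.2} =>
      linCovIter L (1 : Site d → Fin d → ℂˣ) (iEta η φ) p.1.1 p.1.2.1 p.1.2.2) := ⟨_, rfl⟩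
  obtain ⟨Z, hZ⟩ : ∃ Z : ℝ, Z = msup L m η (-(1 : ℝ)) (fun j (b : Site d × Fin d) => j = 0 ∧ SideTouches (c.sq 0) b.1 b.2 ∧
      ¬ BondTouches (c.sq 0) b.1 b.2) (fun b => φ b.1 b.2) := ⟨_, rfl⟩
  have hJX : bondNorm L m η (-(3 : ℝ)) c.sq
      (fun x μ => pdiv η (1 : Site d → Fin d → ℂˣ) (plaqCovDeriv η (1 : Site d → Fin d → ℂˣ) φ) μ x) = X := by rw [hX]; rfl
  rw [hJX, ← hX, ← hY, ← hZ]
  have hL1 : (1 : ℝ) ≤ L := by exact_mod_cast hL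
  have hX0 : 0 ≤ X := by rw [hX]; exact msup_nonneg L m hη.le _ _ _
  have hY0 : 0 ≤ Y := by rw [hY]; exact wsup_nonneg zero_le_one _
  have hZ0 : 0 ≤ Z := by rw [hZ]; exact msup_nonneg L m hη.le _ _ _
  have hB₀0 : 0 ≤ B₀ := zero_le_one.trans hB₀
  -- weights
  have hw3 : ∀ j : ℕ, weight L η (-(3 : ℝ)) j = ((L : ℝ) ^ j * η) ^ 3 := fun j => by simpa using weight_neg_natCast L η 3 j
  have hw2 : ∀ j : ℕ, weight L η (-(2 : ℝ)) j = ((L : ℝ) ^ j * η) ^ 2 := fun j => by simpa using weight_neg_natCast L η 2 j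
  have hw1 : ∀ j : ℕ, weight L η (-(1 : ℝ)) j = (L : ℝ) ^ j * η := fun j => by simpa using weight_neg_natCast L η 1 j
  have hscale : ∀ j, j ≤ m → (L : ℝ) ^ j * η ≤ (L : ℝ) ^ m * η := fun j hj =>
    mul_le_mul_of_nonneg_right (pow_le_pow_right₀ hL1 hj) hη.le
  have hscale0 : ∀ j : ℕ, 0 ≤ (L : ℝ) ^ j * η := fun j => by positivity
  -- Step 1: `φ` is finitely supported, hence uniformly bounded
  obtain ⟨C, hC0, hC⟩ : ∃ C : ℝ, 0 ≤ C ∧ ∀ (y : Site d) (τ : Fin d), ‖φ y τ‖ ≤ C := by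
    have hfin : {q : ℕ × (Site d × Fin d) | q.1 ≤ m ∧ SideTouches (c.sq q.1) q.2.1 q.2.2}.Finite :=
      (sideTouches_pairs_finite L c.a c.M c.ρ hmk (k := c.k) (m := m)).subset fun q hq =>
        ⟨hq.1, sideTouches_mono (c.sq_subset_cubeFam q.1) hq.2⟩
    obtain ⟨C, hC⟩ := (hfin.image fun q : ℕ × (Site d × Fin d) => ‖φ q.2.1 q.2.2‖).bddAbove
    refine ⟨max C 0, le_max_right _ _, fun y τ => ?_⟩
    by_cases h : ∃ j, j ≤ m ∧ SideTouches (c.sq j) y τ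
    · obtain ⟨j, hj, hs⟩ := h
      have hmem : ‖φ y τ‖ ∈ (fun q : ℕ × (Site d × Fin d) => ‖φ q.2.1 q.2.2‖) ''
          {q : ℕ × (Site d × Fin d) | q.1 ≤ m ∧ SideTouches (c.sq q.1) q.2.1 q.2.2} :=
        ⟨(j, (y, τ)), ⟨hj, hs⟩, rfl⟩
      exact (hC hmem).trans (le_max_left _ _)
    · simp only [not_exists, not_and] at h
      rw [hsupp y τ fun j hj hs => h j hj hs, norm_zero]
      exact le_max_right _ _
  -- Step 2: the `Bdd` side conditions of the three right-hand families, and the member-below-sup facts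
  obtain ⟨J₀, hJ₀⟩ : ∃ J₀ : ℝ, J₀ =
      (d : ℝ) * (η⁻¹ * ((η⁻¹ * (C + C) + η⁻¹ * (C + C)) + (η⁻¹ * (C + C) + η⁻¹ * (C + C)))) +
      (d : ℝ) * (η⁻¹ * ((η⁻¹ * (C + C) + η⁻¹ * (C + C)) + (η⁻¹ * (C + C) + η⁻¹ * (C + C)))) := ⟨_, rfl⟩
  have hJ₀0 : 0 ≤ J₀ := by rw [hJ₀]; positivity
  have hJbd : ∀ (μ : Fin d) (x : Site d), ‖Jcur η (1 : Site d → Fin d → ℂˣ) φ μ x‖ ≤ J₀ := fun μ x => by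
    rw [hJ₀]; exact norm_Jcur_flat_le hη hC0 hC μ x
  have hBddJ : Bdd L m η (-(3 : ℝ)) (fun j (b : Site d × Fin d) => BondTouches (c.sq j) b.1 b.2)
      (fun b => Jcur η (1 : Site d → Fin d → ℂˣ) φ b.2 b.1) := by
    refine ⟨((L : ℝ) ^ m * η) ^ 3 * J₀, fun j hj b _ => ?_⟩
    rw [hw3]
    exact mul_le_mul (pow_le_pow_left₀ (hscale0 j) (hscale j hj) 3) (hJbd _ _) (norm_nonneg _) (by positivity)
  have hiEta : ∀ (y : Site d) (κ : Fin d), ‖iEta η φ y κ‖ ≤ η * C := fun y κ => B8Eq146AExpansion.norm_iEta_le hη.le hC y κ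
  have hηC : 0 ≤ η * C := by positivity
  have hQbd : ∀ p : {p : ℕ × (Site d × Fin d) // p.1 ≤ m ∧ I p.1 p.2},
      1 * ‖linCovIter L (1 : Site d → Fin d → ℂˣ) (iEta η φ) p.1.1 p.1.2.1 p.1.2.2‖ ≤ (L : ℝ) ^ m * (η * C) := by
    intro p
    rw [one_mul, linCovIter_one_left L hL _ hηC hiEta p.1.1]
    exact (norm_linQIter_le L hL _ hηC hiEta p.1.1 p.1.2.1 p.1.2.2).trans
      (mul_le_mul_of_nonneg_right (pow_le_pow_right₀ hL1 p.2.1) hηC)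
  have hBddZ : Bdd L m η (-(1 : ℝ)) (fun j (b : Site d × Fin d) => j = 0 ∧ SideTouches (c.sq 0) b.1 b.2 ∧
      ¬ BondTouches (c.sq 0) b.1 b.2) (fun b => φ b.1 b.2) := by
    refine ⟨((L : ℝ) ^ m * η) * C, fun j hj b _ => ?_⟩
    rw [hw1]
    exact mul_le_mul (hscale j hj) (hC _ _) (norm_nonneg _) (by positivity)
  -- (i): every weighted `J` member is below `X`
  have hi : ∀ j, j ≤ m → ∀ (y : Site d) (τ : Fin d), BondTouches (c.sq j) y τ →
      ((L : ℝ) ^ j * η) ^ 3 * ‖Jcur η (1 : Site d → Fin d → ℂˣ) φ τ y‖ ≤ X + Y + Z := by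
    intro j hj y τ hb
    have h := weight_mul_norm_le_msup hBddJ hj (i := (y, τ)) hb
    rw [hw3] at h
    have h' : ((L : ℝ) ^ j * η) ^ 3 * ‖Jcur η (1 : Site d → Fin d → ℂˣ) φ τ y‖ ≤ X := by rw [hX]; exact h
    linarith
  -- (ii): every averaging member on print's class is below `Y` (print's class lies in the index)
  have hii : ∀ j, j ≤ m → ∀ b ∈ Cl j,
      ‖linCovIter L (1 : Site d → Fin d → ℂˣ) (iEta η φ) j b.1 b.2‖ ≤ X + Y + Z := by
    intro j hj b hb
    have h := le_wsup hQbd ⟨(j, b), hj, hI j hj b hb⟩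
    rw [one_mul] at h
    have h' : ‖linCovIter L (1 : Site d → Fin d → ℂˣ) (iEta η φ) j b.1 b.2‖ ≤ Y := by rw [hY]; exact h
    linarith
  -- (iii): off the bonds of `□₀`, `η|φ|` is below the exterior-collar term `Z` (or `φ = 0`)
  have hiii : ∀ (y : Site d) (τ : Fin d), ¬ BondTouches (c.sq 0) y τ → η * ‖φ y τ‖ ≤ X + Y + Z := by
    intro y τ hnb
    by_cases hs : SideTouches (c.sq 0) y τ
    · have h := weight_mul_norm_le_msup hBddZ (Nat.zero_le m) (i := (y, τ)) ⟨rfl, hs, hnb⟩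
      rw [hw1, pow_zero, one_mul] at h
      have h' : η * ‖φ y τ‖ ≤ Z := by rw [hZ]; exact h
      linarith
    · have h0 : φ y τ = 0 := by
        refine hsupp y τ fun j _ hsj => hs ?_
        exact sideTouches_mono (sq_subset_zero c j) hsj
      rw [h0, norm_zero, mul_zero]
      positivity
  -- every bond is a side of a plaquette (`d ≥ 2`)
  haveI : Nontrivial (Fin d) := Fin.nontrivial_iff_two_le.mpr hd2
  have hbs : ∀ (y : Site d) (τ : Fin d) (j : ℕ), BondTouches (c.sq j) y τ →
      SideTouches (c.sq j) y τ := fun y τ j hb => by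
    obtain ⟨κ, hκ⟩ := exists_ne τ
    exact sideTouches_of_bondTouches hκ hb
  -- Step 3: the body at `N := X + Y + Z`
  have hN0 : 0 ≤ X + Y + Z := by positivity
  have hP := hbody φ hLan hsupp (X + Y + Z) hN0 hi hii hiii
  have hRHS : B₀ * (X + Y + Z) = B₀ * (X + Y) + B₀ * Z := by ring
  have hBN0 : 0 ≤ B₀ * (X + Y + Z) := by positivity
  refine ⟨?_, ?_, ?_, ?_⟩
  · -- `|φ|₍₋₁₎`
    rw [← hRHS]
    refine msup_le hBN0 fun j hj b hb => ?_
    rw [hw1]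
    exact (hP j hj b.1 b.2 hb).1
  · -- `|∇φ|₍₋₂₎`
    rw [← hRHS]
    refine msup_le hBN0 fun j hj t ht => ?_
    rw [hw2]
    exact (hP j hj t.2.2 t.2.1 ht).2.1 t.1
  · -- `|∂*∂φ|₍₋₃₎ = |J|₍₋₃₎ = X ≤ B₀(X + Y) + B₀Z` (`B₀ ≥ 1`)
    have h1 : X ≤ B₀ * X := le_mul_of_one_le_left hX0 hB₀
    nlinarith [h1, hY0, hZ0, hB₀0]
  · -- `|Δφ|₍₋₃₎`
    rw [← hRHS]
    refine msup_le hBN0 fun j hj b hb => ?_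
    rw [hw3]
    exact (hP j hj b.1 b.2 (hbs b.1 b.2 j hb)).2.2


#print axioms sc4_of_pointwise159_dented

/-! ## §2 Print's full class of the dented member at every truncation, and its inclusion in the γ split index -/

section Classes

variable {L K : ℕ} {Ω : ℕ → Set (Site d)}

/-- **PRINT'S FULL CONSTRAINT-BOND CLASS OF THE DENTED MEMBER AT TRUNCATION `m`** ([B6] (2.3): inner AND crossing bonds at every level): for `m < k` the truncation sees only
`Ω′_j = □_j`, so it IS dag-n05-c's `cubeLamBP L c.a c.M c.ρ c.k m`; at the top (`m ≥ k`) it is the dented class `c.lamBP` of p659892.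
[cite: Balaban1984PropagatorsII, (2.3) p.224; Balaban1985RegularSpaces, (1.31) p.82, (1.68) p.88; Balaban1985Variational, (148)–(150) p.301] -/
def _root_.Literature.MathematicalPhysics.QuantumFieldTheory.Balaban1983to89.Node00.CubeB8D.lamBPF (c : CubeB8D d L K Ω) (m j : ℕ) : Set (Site d × Fin d) :=
  if m < c.k then cubeLamBP L c.a c.M c.ρ c.k m j else c.lamBP j

variable (c : CubeB8D d L K Ω)

/-- Below the top the full class is the pure member's. [cite: Balaban1985Variational, (150) p.301; Balaban1984PropagatorsII, (2.3) p.224] -/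
theorem lamBPF_of_lt {m : ℕ} (hm : m < c.k) (j : ℕ) : c.lamBPF m j = cubeLamBP L c.a c.M c.ρ c.k m j := by
  unfold CubeB8D.lamBPF; rw [if_pos hm]

/-- At the top the full class is the dented class `c.lamBP`. [cite: Balaban1985Variational, (148) p.301; Balaban1984PropagatorsII, (2.3) p.224] -/
theorem lamBPF_top (j : ℕ) : c.lamBPF c.k j = c.lamBP j := by
  unfold CubeB8D.lamBPF; rw [if_neg (lt_irrefl _)]

/-- At level `0` the «box» of a bond is its pair of end-points: `InBox (loK L 0 z) (bondHiK L 0 z μ) x ⇒ x = z ∨ x = z + e_μ`. [folklore] [cite: Balaban1985Averaging, p.24 (sentence after (43))] -/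
theorem eq_or_eq_of_inBox_level_zero {L : ℕ} {z x : Site d} {μ : Fin d} (hx : InBox (loK L 0 z) (bondHiK L 0 z μ) x) : x = z ∨ x = z + e μ := by
  have hcoord : ∀ i, i ≠ μ → x i = z i := by
    intro i hi
    obtain ⟨h1, h2⟩ := hx i
    simp only [loK, bondHiK, pow_zero, one_mul, if_neg hi] at h1 h2
    omega
  obtain ⟨h1, h2⟩ := hx μ
  simp only [loK, bondHiK, pow_zero, one_mul, if_true] at h1 h2
  rcases (show x μ = z μ ∨ x μ = z μ + 1 by omega) with h | h
  · left; funext i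
    by_cases hi : i = μ
    · subst hi; exact h
    · exact hcoord i hi
  · right; funext i
    by_cases hi : i = μ
    · subst hi; simp [e, h]
    · rw [hcoord i hi]; simp [e, hi]

/-- ★ **THE DENTED LEVEL-0 DICTIONARY** (twin of dag-n05-w3's `mem_cubeLamBP_zero_iff_cubeLamBP'_or_crossB`, at the top truncation): a level-`0` bond belongs to print's dented class
`c.lamBP 0` iff it is an INNER bond of the driver's class `c.lamB c.k 0` (both ends in `Λ′₀`, its two end-points in `□₀`) or it CROSSES `∂□₀` (`CrossB (c.sq 0)`) — for the latter
the pure argument `mem_cubeLamBP_zero_of_crossB` (an end inside `□₁` would have both neighbours in `□₀`, collar `ρ ≥ 1`) gives membership in the pure class, which at level `0`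
lies in the dented one (a weaker deepness exclusion). (`L ≥ 1`, so `ρ ≥ 1`, `k ≥ 1`.)
[cite: Balaban1984PropagatorsII, (2.3) p.224; Balaban1985RegularSpaces, (1.31) p.82, p.77, p.98; Balaban1985Variational, (148)–(150) p.301] -/
theorem mem_lamBP_zero_iff_lamB_or_crossB (hL : 1 ≤ L) (b : Site d × Fin d) :
    b ∈ c.lamBP 0 ↔ b ∈ c.lamB c.k 0 ∨ CrossB (c.sq 0) b := by
  have hk := c.one_le_k
  have hρ : 1 ≤ c.ρ := hL.trans c.L_le_ρ
  have hsq0 : ∀ x, x ∈ c.sq 0 ↔ InBox (sqLo L c.a c.ρ c.k 0) (sqHi L c.a c.M c.ρ c.k 0) x := fun x => by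
    rw [c.sq_zero]
    have := smul_mem_cube_iff hL c.a c.M c.ρ c.k 0 x
    simpa [pow_zero, one_smul] using this
  -- a non-deep site of `□₀^{(0)}` is a level-0 dented cell, and conversely
  have hcell : ∀ z, z ∈ c.lamS 0 ↔ InBox (sqLo L c.a c.ρ c.k 0) (sqHi L c.a c.M c.ρ c.k 0) z ∧
      ¬ (InBox (inLo L c.a c.ρ c.k 0) (inHi L c.a c.M c.ρ c.k 0) z ∧ (0 + 1 = c.k → ∀ x, Under L 0 z x → x ∈ Ω c.k)) := by
    intro z
    have h0 : (0 : ℕ) ≠ c.k := by omega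
    simp only [Node00.CubeB8D.lamS, if_pos (Nat.zero_le _), Set.mem_setOf_eq, h0, IsEmpty.forall_iff, true_and]
    exact ⟨fun h => ⟨h.1, h.2 hk⟩, fun h => ⟨h.1, fun _ => h.2⟩⟩
  constructor
  · intro hb
    rw [mem_lamBP_iff] at hb
    obtain ⟨-, hends, hdeep⟩ := hb
    have h0 : (0 : ℕ) ≠ c.k := by omega
    have hd := hdeep hk
    by_cases hboth : InBox (sqLo L c.a c.ρ c.k 0) (sqHi L c.a c.M c.ρ c.k 0) b.1 ∧ InBox (sqLo L c.a c.ρ c.k 0) (sqHi L c.a c.M c.ρ c.k 0) (b.1 + e b.2)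
    · -- INNER: both ends are level-0 dented cells, the «box» is the two end-points
      left
      refine ⟨fun x hx => ?_, Or.inl ⟨?_, ?_⟩⟩
      · rcases eq_or_eq_of_inBox_level_zero hx with rfl | rfl
        · exact (hsq0 _).2 hboth.1
        · exact (hsq0 _).2 hboth.2
      · rw [lamST_top c]; exact (hcell _).2 ⟨hboth.1, hd.1⟩
      · rw [lamST_top c]; exact (hcell _).2 ⟨hboth.2, hd.2⟩
    · -- CROSSING: exactly one end in `□₀`
      right
      refine ⟨?_, fun h => hboth ⟨(hsq0 _).1 h.1, (hsq0 _).1 h.2⟩⟩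
      rcases hends with h | h
      · exact Or.inl ((hsq0 _).2 h.1)
      · exact Or.inr ((hsq0 _).2 h.1)
  · rintro (hb | hb)
    · -- an inner bond of the driver's class
      obtain ⟨-, hcl⟩ := hb
      rcases hcl with ⟨h1, h2⟩ | ⟨j', hj', -⟩ | ⟨j', hj', -⟩
      · rw [lamST_top c] at h1 h2
        obtain ⟨hs1, hn1⟩ := (hcell _).1 h1
        obtain ⟨hs2, hn2⟩ := (hcell _).1 h2
        have h0 : (0 : ℕ) ≠ c.k := by omega
        rw [mem_lamBP_iff]
        exact ⟨Nat.zero_le _, Or.inl ⟨hs1, fun h => absurd h h0⟩, fun _ => ⟨hn1, hn2⟩⟩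
      · exact absurd hj' (Nat.succ_ne_zero j').symm
      · exact absurd hj' (Nat.succ_ne_zero j').symm
    · -- a crossing bond: in the pure class at level 0, hence in the dented one
      have hb' : CrossB (cubeFam false L c.a c.M c.ρ c.k 0) b := by rw [cubeFam_false_zero, ← c.sq_zero]; exact hb
      have hp := mem_cubeLamBP_zero_of_crossB hL c.a c.M hρ hk c.k hb'
      rw [mem_cubeLamBP_iff] at hp
      obtain ⟨-, hends, hdeep⟩ := hp
      have h0 : (0 : ℕ) ≠ c.k := by omega
      rw [mem_lamBP_iff]
      refine ⟨Nat.zero_le _, ?_, fun h => ⟨fun hh => (hdeep h).1 hh.1, fun hh => (hdeep h).2 hh.1⟩⟩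
      rcases hends with h | h
      · exact Or.inl ⟨h, fun hh => absurd hh h0⟩
      · exact Or.inr ⟨h, fun hh => absurd hh h0⟩

/-- ★ **PRINT'S FULL DENTED CLASS LIES IN THE γ SPLIT INDEX** at every truncation `1 ≤ m ≤ k`: `c.lamBPF m j ⊆ c.lamBPT m j ∪ {level-0 crossing bonds of Ω′₀}` — below the top by
Fγ10a's `cubeLamBP_sub_splitIndex` (pure), at the top by the dented level-0 dictionary and `lamBPT_top_of_ne_zero`. [cite: Balaban1985RegularSpaces, (1.31) p.82, p.77; Balaban1984PropagatorsII, (2.3) p.224; Balaban1985Variational, (148)–(150) p.301] -/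
theorem lamBPF_sub_splitIndex (hL : 1 ≤ L) {m : ℕ} (hm1 : 1 ≤ m) (hmk : m ≤ c.k) :
    ∀ j, j ≤ m → ∀ b ∈ c.lamBPF m j, (b ∈ c.lamBPT m j ∨ (j = 0 ∧ CrossB (c.sq 0) b)) := by
  intro j hj b hb
  have hρ : 1 ≤ c.ρ := hL.trans c.L_le_ρ
  rcases lt_or_eq_of_le hmk with hlt | heq
  · rw [lamBPF_of_lt c hlt] at hb
    rw [lamBPT_of_lt c hlt, c.sq_zero, ← cubeFam_false_zero L c.a c.M c.ρ c.k]
    exact cubeLamBP_sub_splitIndex hL c.a c.M hρ hm1 hmk j hj b hb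
  · subst heq
    rw [lamBPF_top] at hb
    rcases Nat.eq_zero_or_pos j with rfl | hj1
    · rw [lamBPT_top_zero]
      rcases (mem_lamBP_zero_iff_lamB_or_crossB c hL b).1 hb with h | h
      · exact Or.inl h
      · exact Or.inr ⟨rfl, h⟩
    · exact Or.inl (by rw [lamBPT_top_of_ne_zero c (Nat.pos_iff_ne_zero.mp hj1)]; exact hb)

end Classes

/-! ## §3 The UNIFORM four-line clause at every truncation of the dented member, from the two named facts -/

section Uniform

variable {L : ℕ}

/-- ★★ **THE SCALAR FOUR-LINE (1.59) CLAUSE AT `U₀ = 1`, UNIFORMLY ON PRINT's BIG-BLOCK SUB-LATTICE, AT EVERY TRUNCATION OF EVERY DENTED MEMBER, FROM THE TWO NAMED FACTS** — the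
pure `Ineq159FlatCubeMemberPrinted d L` (truncations `m < k`: the truncated dented tower IS the pure member's; [4] Thm 3.3 at `U = 1` on the Dirichlet cube, PROVED in the tree
for odd `L ≥ 5`) and the dented `Ineq159FlatDentedCubeMemberPrinted d L` (the top truncation `m = k` of [15]'s local sequence `{Ω′_j}`; OPEN): one constant `B₀ ≥ 1` and thresholds
`ρ₀, M₀, N₀, R₀` such that at every dented datum `c` of the sub-lattice (`M_h = Lˢ`: `M₀ ≤ L^{s+1}`, `L^{s+1} ∣ c.ρ`, `L^{s+1} ∣ c.M`, `R·L^{s+1} ≤ c.ρ`, `R₀ ≤ R`, `N₀ + 1 ≤ R·L^{s+1}`,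
`ρ₀ ≤ c.ρ`) whose `Ω_k` is a union of `L^{s+1}Lᵏ`-cubes of the grid anchored at `□_k`'s corner, every truncation `1 ≤ m ≤ c.k`, every index predicate `I ⊇ c.lamBPF m` and every `φ`
in the flat Landau gauge for `(Ω′₀, c.lamST m)` with the support clause, the four-line clause of §1 holds over the dented tower with `B_∂ := B₀`.
[cite: Balaban1985RegularSpaces, (1.59) p.86, (1.62) p.87, (1.31) p.82, (1.131)–(1.132) p.99, p.98; Balaban1985Variational, (148)–(152) p.301; Balaban1985BackgroundPropagators, Thm 3.3 p.399; Balaban1984PropagatorsII, Prop. 2.6 (2.136) p.247, (2.3) p.224] -/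
theorem sc4_dented_of_ineq159Printed (hd2 : 2 ≤ d) (hL : 1 ≤ L) (h159 : Ineq159FlatCubeMemberPrinted d L) (h159D : Ineq159FlatDentedCubeMemberPrinted d L) :
    ∃ B₀ ρ₀ M₀ : ℝ, ∃ N₀ R₀ : ℕ, 1 ≤ B₀ ∧
    ∀ (η : ℝ), 0 < η → ∀ {K : ℕ} {Ω : ℕ → Set (Site d)} (c : CubeB8D d L K Ω) (s R : ℕ),
      M₀ ≤ (L : ℝ) ^ (s + 1) → L ^ (s + 1) ∣ c.ρ → L ^ (s + 1) ∣ c.M → R * L ^ (s + 1) ≤ c.ρ → R₀ ≤ R →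
      N₀ + 1 ≤ R * L ^ (s + 1) → ρ₀ ≤ (c.ρ : ℝ) →
      (∀ x y : Site d,
          blockMap (L ^ (s + 1) * L ^ c.k) (x - fun i => (L : ℤ) ^ c.k * (c.a i - c.ρ)) =
            blockMap (L ^ (s + 1) * L ^ c.k) (y - fun i => (L : ℤ) ^ c.k * (c.a i - c.ρ)) → x ∈ Ω c.k → y ∈ Ω c.k) →
      ∀ m, 1 ≤ m → m ≤ c.k → ∀ (I : ℕ → Site d × Fin d → Prop), (∀ j, j ≤ m → ∀ b ∈ c.lamBPF m j, I j b) →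
      ∀ φ : Site d → Fin d → ℂ,
        IsLandau138 L m η (c.sq 0) (c.lamST m) (1 : Site d → Fin d → ℂˣ) φ →
        (∀ (y : Site d) (τ : Fin d), (∀ j, j ≤ m → ¬ SideTouches (c.sq j) y τ) → φ y τ = 0) →
        msup L m η (-(1 : ℝ)) (fun j (b : Site d × Fin d) => SideTouches (c.sq j) b.1 b.2) (fun b => φ b.1 b.2)
            ≤ B₀ * (bondNorm L m η (-(3 : ℝ)) c.sq (fun x μ => Jcur η (1 : Site d → Fin d → ℂˣ) φ μ x)
              + wsup 1 (fun p : {p : ℕ × (Site d × Fin d) // p.1 ≤ m ∧ I p.1 p.2} =>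
                  linCovIter L (1 : Site d → Fin d → ℂˣ) (iEta η φ) p.1.1 p.1.2.1 p.1.2.2))
              + B₀ * msup L m η (-(1 : ℝ)) (fun j (b : Site d × Fin d) => j = 0 ∧ SideTouches (c.sq 0) b.1 b.2 ∧
                  ¬ BondTouches (c.sq 0) b.1 b.2) (fun b => φ b.1 b.2) ∧
          msup L m η (-(2 : ℝ)) (fun j (t : Fin d × Fin d × Site d) => SideTouches (c.sq j) t.2.2 t.2.1)
              (fun t => covDerivFwd η (1 : Site d → Fin d → ℂˣ) t.1 (fun z => φ z t.2.1) t.2.2)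
            ≤ B₀ * (bondNorm L m η (-(3 : ℝ)) c.sq (fun x μ => Jcur η (1 : Site d → Fin d → ℂˣ) φ μ x)
              + wsup 1 (fun p : {p : ℕ × (Site d × Fin d) // p.1 ≤ m ∧ I p.1 p.2} =>
                  linCovIter L (1 : Site d → Fin d → ℂˣ) (iEta η φ) p.1.1 p.1.2.1 p.1.2.2))
              + B₀ * msup L m η (-(1 : ℝ)) (fun j (b : Site d × Fin d) => j = 0 ∧ SideTouches (c.sq 0) b.1 b.2 ∧
                  ¬ BondTouches (c.sq 0) b.1 b.2) (fun b => φ b.1 b.2) ∧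
          bondNorm L m η (-(3 : ℝ)) c.sq
              (fun x μ => pdiv η (1 : Site d → Fin d → ℂˣ) (plaqCovDeriv η (1 : Site d → Fin d → ℂˣ) φ) μ x)
            ≤ B₀ * (bondNorm L m η (-(3 : ℝ)) c.sq (fun x μ => Jcur η (1 : Site d → Fin d → ℂˣ) φ μ x)
              + wsup 1 (fun p : {p : ℕ × (Site d × Fin d) // p.1 ≤ m ∧ I p.1 p.2} =>
                  linCovIter L (1 : Site d → Fin d → ℂˣ) (iEta η φ) p.1.1 p.1.2.1 p.1.2.2))
              + B₀ * msup L m η (-(1 : ℝ)) (fun j (b : Site d × Fin d) => j = 0 ∧ SideTouches (c.sq 0) b.1 b.2 ∧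
                  ¬ BondTouches (c.sq 0) b.1 b.2) (fun b => φ b.1 b.2) ∧
          bondNorm L m η (-(3 : ℝ)) c.sq (fun x μ => covLap η (1 : Site d → Fin d → ℂˣ) (fun z => φ z μ) x)
            ≤ B₀ * (bondNorm L m η (-(3 : ℝ)) c.sq (fun x μ => Jcur η (1 : Site d → Fin d → ℂˣ) φ μ x)
              + wsup 1 (fun p : {p : ℕ × (Site d × Fin d) // p.1 ≤ m ∧ I p.1 p.2} =>
                  linCovIter L (1 : Site d → Fin d → ℂˣ) (iEta η φ) p.1.1 p.1.2.1 p.1.2.2))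
              + B₀ * msup L m η (-(1 : ℝ)) (fun j (b : Site d × Fin d) => j = 0 ∧ SideTouches (c.sq 0) b.1 b.2 ∧
                  ¬ BondTouches (c.sq 0) b.1 b.2) (fun b => φ b.1 b.2) := by
  obtain ⟨B₀, ρ₀, M₀, N₀, R₀, hB₀, H⟩ := h159
  obtain ⟨B₁, ρ₁, M₁, N₁, R₁, hB₁, HD⟩ := h159D
  refine ⟨max (max B₀ B₁) 1, max ρ₀ ρ₁, max M₀ M₁, max N₀ N₁, max R₀ R₁, le_max_right _ _, ?_⟩
  intro η hη K Ω c s R hM₀ hdρ hdM hR hR₀ hN₀ hρ₀ hΩ m hm1 hmk I hI φ hLan hsupp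
  have hk := c.one_le_k
  have hρL : L ≤ c.ρ := c.L_le_ρ
  have hB : max B₀ B₁ ≤ max (max B₀ B₁) 1 := le_max_left _ _
  have hM₀' : M₀ ≤ (L : ℝ) ^ (s + 1) := (le_max_left _ _).trans hM₀
  have hM₁' : M₁ ≤ (L : ℝ) ^ (s + 1) := (le_max_right _ _).trans hM₀
  have hR₀' : R₀ ≤ R := (le_max_left _ _).trans hR₀
  have hR₁' : R₁ ≤ R := (le_max_right _ _).trans hR₀
  have hN₀' : N₀ + 1 ≤ R * L ^ (s + 1) := le_trans (Nat.succ_le_succ (le_max_left _ _)) hN₀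
  have hN₁' : N₁ + 1 ≤ R * L ^ (s + 1) := le_trans (Nat.succ_le_succ (le_max_right _ _)) hN₀
  have hρ₀' : ρ₀ ≤ (c.ρ : ℝ) := (le_max_left _ _).trans hρ₀
  have hρ₁' : ρ₁ ≤ (c.ρ : ℝ) := (le_max_right _ _).trans hρ₀
  refine sc4_of_pointwise159_dented hd2 hL hη c hmk (le_max_right _ _) (c.lamBPF m) I hI
    (fun ψ hψ hψ0 N hN h1 h2 h3 j hj y τ hs => ?_) φ hLan hsupp
  rcases lt_or_eq_of_le hmk with hlt | heq
  · -- `m < k`: the truncated dented tower is the pure member's — the PURE fact, letter by letter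
    have hsqj : ∀ j', j' ≤ m → c.sq j' = cubeFam false L c.a c.M c.ρ c.k j' := fun j' hj' => by
      rw [c.sq_of_lt (lt_of_le_of_lt hj' hlt), cubeFam_false_of_le L c.a c.M c.ρ (hj'.trans hmk)]
    have hψ' : IsLandau138 L m η (cubeFam false L c.a c.M c.ρ c.k 0) (cubeLamS L c.a c.M c.ρ c.k m) (1 : Site d → Fin d → ℂˣ) ψ := by
      rw [← hsqj 0 (Nat.zero_le m), ← lamST_of_lt c hlt]; exact hψ
    have hψ0' : ∀ (y : Site d) (τ : Fin d), (∀ j', j' ≤ m → ¬ SideTouches (cubeFam false L c.a c.M c.ρ c.k j') y τ) → ψ y τ = 0 :=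
      fun y τ h => hψ0 y τ fun j' hj' => by rw [hsqj j' hj']; exact h j' hj'
    have h1' : ∀ j', j' ≤ m → ∀ (y : Site d) (τ : Fin d), BondTouches (cubeFam false L c.a c.M c.ρ c.k j') y τ →
        ((L : ℝ) ^ j' * η) ^ 3 * ‖Jcur η (1 : Site d → Fin d → ℂˣ) ψ τ y‖ ≤ N :=
      fun j' hj' y τ hb => h1 j' hj' y τ (by rw [hsqj j' hj']; exact hb)
    have h2' : ∀ j', j' ≤ m → ∀ b ∈ cubeLamBP L c.a c.M c.ρ c.k m j', ‖linCovIter L (1 : Site d → Fin d → ℂˣ) (iEta η ψ) j' b.1 b.2‖ ≤ N :=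
      fun j' hj' b hb => h2 j' hj' b (by rw [lamBPF_of_lt c hlt]; exact hb)
    have h3' : ∀ (y : Site d) (τ : Fin d), ¬ BondTouches (cubeFam false L c.a c.M c.ρ c.k 0) y τ → η * ‖ψ y τ‖ ≤ N :=
      fun y τ hb => h3 y τ (by rw [hsqj 0 (Nat.zero_le m)]; exact hb)
    have hs' : SideTouches (cubeFam false L c.a c.M c.ρ c.k j) y τ := by rw [← hsqj j hj]; exact hs
    obtain ⟨q1, q2, q3⟩ := H η hη c.a c.M c.ρ c.k s R hk hM₀' hdρ hdM hR hR₀' hN₀' hρ₀' m hm1 hmk ψ hψ' hψ0' N hN h1' h2' h3' j hj y τ hs'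
    have hmono : B₀ * N ≤ max (max B₀ B₁) 1 * N := mul_le_mul_of_nonneg_right ((le_max_left _ _).trans hB) hN
    exact ⟨q1.trans hmono, fun ν => (q2 ν).trans hmono, q3.trans hmono⟩
  · -- `m = k`: the DENTED fact verbatim
    subst heq
    have hψ' : IsLandau138 L c.k η (c.sq 0) c.lamS (1 : Site d → Fin d → ℂˣ) ψ := by rw [← lamST_top c]; exact hψ
    have h2' : ∀ j', j' ≤ c.k → ∀ b ∈ c.lamBP j', ‖linCovIter L (1 : Site d → Fin d → ℂˣ) (iEta η ψ) j' b.1 b.2‖ ≤ N :=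
      fun j' hj' b hb => h2 j' hj' b (by rw [lamBPF_top]; exact hb)
    obtain ⟨q1, q2, q3⟩ := HD η hη K Ω c s R hM₁' hdρ hdM hR hR₁' hN₁' hρ₁' hΩ ψ hψ' hψ0 N hN h1 h2' h3 j hj y τ hs
    have hmono : B₁ * N ≤ max (max B₀ B₁) 1 * N := mul_le_mul_of_nonneg_right ((le_max_right _ _).trans hB) hN
    exact ⟨q1.trans hmono, fun ν => (q2 ν).trans hmono, q3.trans hmono⟩

#print axioms sc4_dented_of_ineq159Printed

end Uniform

end Literature.MathematicalPhysics.QuantumFieldTheory.Balaban1983to89.B8Ineq159FlatDentedCubeMemberSCGamma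

end
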